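import Literature.AlgebraicGeometry.Motives.FunctionFieldOver
import Mathlib.AlgebraicGeometry.Morphisms.UniversallyInjective

/-!
# `Picover`, line `degree-p-tower`: radicial dominant morphisms induce purely inseparable extensions of function fields

Helper for item `stmt-ResolutionOfSingularities-0554` (crux decl
`Summit.ResolutionOfSingularities.ResolutionOfSingularities.Theses.PAlteration.Picover`), line
`degree-p-tower`, stub `stub_functionFieldRadicial`.

**Statement.** For a universally injective (radicial) dominant morphism `g : X ⟶ Y` of integral
schemes, the extension of function fields `K(X)/K(Y)` — in-tree `FunctionFieldOver g`, whose
`K(Y)`-algebra structure is `RatFn.functionFieldMap g = g^♯_{ξ_X} ∘ (K(Y) → 𝒪_{Y, g ξ_X})` — is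
purely inseparable.

**Proof.** By Stacks 01S4 (Mathlib `AlgebraicGeometry.tfae_universallyInjective`) a universally
injective morphism has purely inseparable residue field extensions `κ(g x) → κ(x)`; take
`x = ξ_X`. As `g ξ_X = ξ_Y` (`g` dominant), the cospecialisation `K(Y) = 𝒪_{Y, ξ_Y} → 𝒪_{Y, g ξ_X}`
is an isomorphism, and the residue maps `𝒪_{Y, g ξ_X} → κ(g ξ_X)`, `K(X) = 𝒪_{X, ξ_X} → κ(ξ_X)` are
surjective ring homomorphisms out of fields, hence bijective. By naturality of the residue maps
(`Scheme.residue_residueFieldMap`), `K(Y) → K(X)` is the composite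
`K(Y) → κ(g ξ_X) → κ(ξ_X) ≅ K(X)` of a surjection, a purely inseparable map and a ring
isomorphism; surjective ring homomorphisms are purely inseparable and pure inseparability is
stable under composition for fields (`RingHom.IsPurelyInseparable.comp`).

Sources: Stacks Project, Tags 01S2–01S4 (radicial morphisms); Görtz–Wedhorn, *Algebraic
Geometry I*, (11.16) (function field extension along a dominant morphism). Nothing here is
specific to finite morphisms: finiteness of `K(X)/K(Y)` is NOT part of this file.
-/

noncomputable section

set_option linter.dupNamespace false -- mandated namespace of this single-conjunct summit

open CategoryTheory AlgebraicGeometry TopologicalSpace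
open Literature.AlgebraicGeometry.Motives

namespace Summit.ResolutionOfSingularities.ResolutionOfSingularities.Theorems.Picover.FunctionFieldRadicial

/-- A surjective ring homomorphism is purely inseparable: the target is integral over the source
(`Algebra.isIntegral_of_surjective`) and every element is in the image. [folklore] -/
theorem isPurelyInseparable_of_surjective {F E : Type*} [CommRing F] [CommRing E] (f : F →+* E)
    (hf : Function.Surjective f) : f.IsPurelyInseparable := by
  letI := f.toAlgebra
  show IsPurelyInseparable F E
  exact ⟨Algebra.isIntegral_of_surjective hf, fun x _ => hf x⟩

/-- On an integral scheme, the cospecialisation map `K(Y) = 𝒪_{Y, ξ_Y} → 𝒪_{Y, g ξ_X}` along a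
dominant `g : X ⟶ Y` (for which `g ξ_X = ξ_Y`) is an isomorphism. [folklore] -/
theorem isIso_stalkSpecializes_genericPoint {X Y : Scheme.{0}} [IsIntegral X] [IsIntegral Y]
    (g : X ⟶ Y) [IsDominant g] :
    IsIso (Y.presheaf.stalkSpecializes (RatFn.specializes_genericPoint g)) := by
  have hη : g (genericPoint X) = genericPoint Y := RatFn.genericPoint_eq_of_isDominant g
  have key : ∀ (y : Y) (h : y ⤳ genericPoint Y), y = genericPoint Y →
      IsIso (Y.presheaf.stalkSpecializes h) := by
    rintro y h rfl
    rw [show Y.presheaf.stalkSpecializes h = 𝟙 _ from TopCat.Presheaf.stalkSpecializes_refl _ _]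
    infer_instance
  exact key _ _ hη

/-- **Factorisation of `g^♯ : K(Y) → K(X)` through the residue fields at the generic points.**
For a dominant morphism `g : X ⟶ Y` of integral schemes, `RatFn.functionFieldMap g` is the
composite of `K(Y) → 𝒪_{Y, g ξ_X} → κ(g ξ_X)`, the residue field map `κ(g ξ_X) → κ(ξ_X)` of `g`
at `ξ_X`, and the inverse of the (bijective) residue map `K(X) = 𝒪_{X, ξ_X} → κ(ξ_X)`.
[folklore] -/
theorem functionFieldMap_eq_comp_residueFieldMap {X Y : Scheme.{0}} [IsIntegral X] [IsIntegral Y]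
    (g : X ⟶ Y) [IsDominant g]
    (eX : X.presheaf.stalk (genericPoint X) ≃+* X.residueField (genericPoint X))
    (heX : ∀ t, eX t = X.residue (genericPoint X) t) :
    RatFn.functionFieldMap g =
      eX.symm.toRingHom.comp ((g.residueFieldMap (genericPoint X)).hom.comp
        ((Y.residue (g (genericPoint X))).hom.comp
          (Y.presheaf.stalkSpecializes (RatFn.specializes_genericPoint g)).hom)) := by
  have hnat := congrArg CommRingCat.Hom.hom (Scheme.residue_residueFieldMap g (genericPoint X))
  simp only [CommRingCat.hom_comp] at hnat
  ext x
  simp only [RatFn.functionFieldMap, CommRingCat.hom_comp, RingHom.coe_comp, Function.comp_apply,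
    RingEquiv.toRingHom_eq_coe, RingHom.coe_coe]
  apply eX.injective
  rw [RingEquiv.apply_symm_apply, heX]
  exact (RingHom.congr_fun hnat _).symm

/-- **A universally injective dominant morphism of integral schemes induces a purely inseparable
extension of function fields** `K(X)/K(Y)` (Stacks 01S2/01S4: universally injective iff injective
with purely inseparable residue field extensions; at the generic points the residue fields are
the function fields). [folklore] -/
theorem stub_functionFieldRadicial : ∀ (X Y : Scheme.{0}) [IsIntegral X] [IsIntegral Y] (g : X ⟶ Y) [UniversallyInjective g] [IsDominant g], IsPurelyInseparable Y.functionField (FunctionFieldOver g) := by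
  intro X Y _ _ g _ _
  -- Stacks 01S4: the residue field extension at the generic point of `X` is purely inseparable
  have h02 : UniversallyInjective g ↔
      Function.Injective g ∧ ∀ x, (g.residueFieldMap x).hom.IsPurelyInseparable :=
    (tfae_universallyInjective g).out 0 2
  have hφ : (g.residueFieldMap (genericPoint X)).hom.IsPurelyInseparable :=
    (h02.mp ‹UniversallyInjective g›).2 _
  letI instX : Field (X.presheaf.stalk (genericPoint X)) := inferInstanceAs (Field X.functionField)
  letI instY : Field (Y.presheaf.stalk (genericPoint Y)) := inferInstanceAs (Field Y.functionField)
  -- the cospecialisation `K(Y) → 𝒪_{Y, g ξ_X}` is surjective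
  haveI := isIso_stalkSpecializes_genericPoint g
  have hs : Function.Surjective
      (Y.presheaf.stalkSpecializes (RatFn.specializes_genericPoint g)).hom :=
    (ConcreteCategory.bijective_of_isIso
      (Y.presheaf.stalkSpecializes (RatFn.specializes_genericPoint g))).2
  -- the residue map `K(X) → κ(ξ_X)` is bijective
  have hrX : Function.Bijective (X.residue (genericPoint X)).hom :=
    ⟨(X.residue (genericPoint X)).hom.injective, X.residue_surjective _⟩
  let eX : X.presheaf.stalk (genericPoint X) ≃+* X.residueField (genericPoint X) :=
    RingEquiv.ofBijective _ hrX
  have hfac := functionFieldMap_eq_comp_residueFieldMap g eX fun _ => rfl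
  -- `K(Y) → κ(g ξ_X)` is surjective, hence purely inseparable
  have h1 : ((Y.residue (g (genericPoint X))).hom.comp
      (Y.presheaf.stalkSpecializes (RatFn.specializes_genericPoint g)).hom).IsPurelyInseparable :=
    isPurelyInseparable_of_surjective _ ((Y.residue_surjective _).comp hs)
  have h2 := RingHom.IsPurelyInseparable.comp h1 hφ
  have h3 := RingHom.IsPurelyInseparable.comp h2
    (isPurelyInseparable_of_surjective eX.symm.toRingHom eX.symm.surjective)
  have h4 : (RatFn.functionFieldMap g).IsPurelyInseparable := by
    rw [hfac]
    exact h3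
  rw [← RingHom.isPurelyInseparable_algebraMap_iff]
  exact h4

end Summit.ResolutionOfSingularities.ResolutionOfSingularities.Theorems.Picover.FunctionFieldRadicial

end
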